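import Summits.BirchSwinnertonDyer.Rank1Residual.X6.RankZeroCertificateErratum
import HarnessLib

/-!
# Class X6 ∧ analytic rank `0` — the SHAPE of the Rest records: all-split at `p ≥ 5`, and the census of the
# second disjunct of `¬ HasErratumPrime` (a non-split `q` with `p ∣ ord_q Δ_min`), decided IN THE KERNEL

Cell `bsd-print-x6` (D-0131 (2) print tier, key `x6`; HOME `run/shared/lean/pub/bsd-print-x6/`), typer seat ty3 (gen 4).
Sibling of `RankZeroCertificateErratum.lean` (the certificates `Record.errAt` / `Record.restAt`, the kernel theorems
`Record.hasErratumPrime_of_check` / `Record.not_hasErratumPrime_of_check`, `Record.split_of_mem_bad`) and of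
`RankZeroCertificateErratumDisplay.lean` (the Err ∣ Rest partition 107 / 6 at `p ≥ 5`, 544 / 77 at `p = 3`); it imports
only the former. PARTITION (D-0054): leaf X6 ∧ r = 0 (K3 row A6) — types-the-object-of; closes NONE. HONEST FRAMING:
nothing here asserts BSD or any `L`-value; reduction types of an explicit minimal model are PROVED per record from
kernel-rechecked integer data; analytic rank `0` and `#Ш_an` of a record remain CLAIMS (`RankZeroCertificateClaim.lean`).

WHY (the reading of the RESIDUAL child `EisensteinHalfFiveLeRest`, item stmt-BirchSwinnertonDyer-21116, refuter note
2026-08-27T17:41Z): with `ClassX6` (semistable), `¬ HasErratumPrime W p` says that every multiplicative prime `q` is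
split OR has `p ∣ ord_q(Δ_min)` — two disjuncts; the census certificate `Record.restAt := ∀ listed bad (q, v),
splitAt ∨ p ∣ v` is exactly that reading. This file records, as kernel theorems on the 734 literal records, how the
second disjunct is used:

* §1 (generic): `Record.split_of_mult_of_all_splitAt` — if EVERY listed bad prime carries the split certificate, then
  every multiplicative prime of the record's curve is split multiplicative (every bad prime of the certified minimal
  model is listed, `Record.mem_badPrimes_of_not_good`).
* §2 (data, `decide +kernel`): at `p ≥ 5` the six Rest records (`138594b1, 246697a1, 321518d1, 331554a1 @ 5`,
  `12927e1, 399190l1 @ 7`) are **ALL-SPLIT** (`rest_five_le_all_splitAt`: 0 of 6 use the second disjunct); a listed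
  non-split `q` with `p ∣ ord_q Δ` occurs on exactly **15 of the 113** records at `p ≥ 5`, every one of them an Err
  record through ANOTHER non-split prime with `p ∤ ord Δ` (`secondDisjunct_five_le`); at `p = 3` (record only; road
  (E) is `p ≥ 5`) the 77 Rest records are 42 all-split + **35 relying on the second disjunct**, and 151 of the 544 Err
  records also carry such a prime (`secondDisjunct_three_counts`).
* §3 (display): `split_of_mult_of_mem_rest_five_le` — for a listed Rest pair at `p ≥ 5`, every multiplicative prime is
  split; and the Rest child's census cell in the `hWeq` shape of the cell files:
  `split_of_mult_cell_138594b1_at5 (hWeq : W = ⟨1, 0, 0, -1443, -21219⟩) : Mult W q → SplitMult W q`.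

TWO ENGINES for the column (cell rule R-0.5): (1) pure Python from the a-invariants (Euler's criterion on `−c₆`, parity
at `2`) = PARI/GP 2.17.2 `ellap` signs at every bad prime of every record (kit j279191), 0 mismatches — table
`HOME/ty3/erratum/X6R0-ERRATUM-v1.tsv` (columns `bad(q,vDisc)`, `split_per_q`, `allSplit`), recount in
`evidence ty3-g4-erratum-kernel-inhabitants.md` on stmt-21115/21116; (2) the Lean kernel (§2). Both: 6/6 all-split and
15 second-disjunct records at `p ≥ 5`; 42 + 35 and 151 at `p = 3`.

References: J. H. Silverman, *AEC* (2009) VII.5 Prop. 5.1 [SilvermanAEC2009]; J. E. Cremona, the elliptic curve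
database [Cremona2006].
-/

set_option autoImplicit false

open WeierstrassCurve Literature.NumberTheory.EllipticCurves
  Literature.NumberTheory.EllipticCurves.Rank1Residual
  Summit.BirchSwinnertonDyer.Rank1Residual.Supersingular

namespace Summit.BirchSwinnertonDyer.Rank1Residual.X6.PrintCert

/-! ### §1 Generic: an all-split certificate makes every multiplicative prime split -/

namespace Record

variable (r : Record)

/-- **All-split shape of a certified record**: if every listed bad `(q, v_q Δ)` carries the split certificate
`splitAt`, then EVERY prime of multiplicative reduction of the record's (minimal) curve is split multiplicative —
a multiplicative prime is bad, hence listed (`mem_badPrimes_of_not_good`), hence split (`split_of_mem_bad`).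
[cite: SilvermanAEC2009, VII.5 Prop. 5.1(a) and (b)] -/
theorem split_of_mult_of_all_splitAt (hc : r.check = true) [r.curve.IsElliptic] [r.curve.IsGloballyMinimal]
    (hall : (r.bad.all fun t => splitAt r.ainvs t.1) = true) (q : ℕ) [Fact q.Prime]
    (hmult : r.curve.HasMultiplicativeReductionAtPrime q) :
    r.curve.HasSplitMultiplicativeReductionAtPrime q := by
  have hbad : ¬ r.curve.HasGoodReductionAtPrime q :=
    fun hgood => WeierstrassCurve.HasMultiplicativeReduction.not_hasGoodReduction (R := ℤ_[q]) hmult hgood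
  have hmem := r.mem_badPrimes_of_not_good hc (Fact.out : q.Prime) hbad
  obtain ⟨⟨q', v⟩, ht, htq⟩ := r.exists_mem_bad_of_mem_badPrimes hmem
  have hqq : q' = q := htq
  subst hqq
  exact r.split_of_mem_bad hc ht (List.all_eq_true.mp hall (q', v) ht)

/-- With an all-split certificate the Rest certificate holds trivially (first disjunct everywhere). [folklore] -/
theorem restAt_of_all_splitAt (hall : (r.bad.all fun t => splitAt r.ainvs t.1) = true) : r.restAt = true := by
  rw [restAt, List.all_eq_true]
  intro t ht
  rw [Bool.or_eq_true]
  exact Or.inl (List.all_eq_true.mp hall t ht)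

end Record

/-! ### §2 The data: all-split Rest records at `p ≥ 5`; the census of the second disjunct -/

/-- **The six Rest records at `p ≥ 5` are ALL-SPLIT**: every listed bad prime of `138594b1, 246697a1, 321518d1,
331554a1 @ 5` and `12927e1, 399190l1 @ 7` carries the split certificate — none of them uses the disjunct
`p ∣ ord_q Δ` of `restAt`. [cite: Cremona2006, Table 1 (Cremona labels)] -/
theorem rest_five_le_all_splitAt :
    ((allRecords.filter fun r => 5 ≤ r.p ∧ r.restAt = true).all
        fun r => r.bad.all fun t => splitAt r.ainvs t.1) = true ∧
    ((allRecords.filter fun r => 5 ≤ r.p ∧ r.restAt = true).map Record.label) =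
      ["138594b1", "246697a1", "321518d1", "331554a1", "12927e1", "399190l1"] := by
  decide +kernel

/-- **Census of the second disjunct at `p ≥ 5`**: a listed bad prime certified NON-split (`nonsplitCert`) with
`p ∣ v_q(Δ)` occurs on exactly 15 of the 113 records, with these labels (12 at `p = 5`, then 3 at `p = 7`), and every
one of them is an Err record (`errAt`: another listed non-split prime has `p ∤ v`). [cite: Cremona2006, Table 1
(Cremona labels)] -/
theorem secondDisjunct_five_le :
    ((allRecords.filter fun r => 5 ≤ r.p ∧
        (r.bad.any fun t => nonsplitCert r.ainvs t.1 && decide (r.p ∣ t.2)) = true).map Record.label) =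
      ["15953a1", "71078b1", "75966b1", "96502a1", "120974c1", "123918c1", "204378l1", "266538b1", "330486d1",
        "377067b1", "386358b1", "428538a1", "234718a1", "270618c1", "441330q1"] ∧
    ((allRecords.filter fun r => 5 ≤ r.p ∧
        (r.bad.any fun t => nonsplitCert r.ainvs t.1 && decide (r.p ∣ t.2)) = true).all Record.errAt) = true := by
  decide +kernel

/-- **Census of the second disjunct at `p = 3`** (record only; road (E) is `p ≥ 5`): of the 77 Rest records, 42 are
all-split and 35 rely on a non-split `q` with `3 ∣ v_q(Δ)`; such a prime occurs on 186 of the 621 records, 151 of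
them Err. [cite: Cremona2006, Table 1 (Cremona labels)] -/
theorem secondDisjunct_three_counts :
    ((allRecords.filter fun r => r.p = 3 ∧ r.restAt = true ∧
        (r.bad.all fun t => splitAt r.ainvs t.1) = true).length = 42) ∧
    ((allRecords.filter fun r => r.p = 3 ∧ r.restAt = true ∧
        (r.bad.any fun t => nonsplitCert r.ainvs t.1 && decide (r.p ∣ t.2)) = true).length = 35) ∧
    ((allRecords.filter fun r => r.p = 3 ∧
        (r.bad.any fun t => nonsplitCert r.ainvs t.1 && decide (r.p ∣ t.2)) = true).length = 186) ∧
    ((allRecords.filter fun r => r.p = 3 ∧ r.errAt = true ∧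
        (r.bad.any fun t => nonsplitCert r.ainvs t.1 && decide (r.p ∣ t.2)) = true).length = 151) := by
  decide +kernel

/-! ### §3 The display: every multiplicative prime is split at a Rest pair with `p ≥ 5` -/

/-- **At a listed Rest pair with `p ≥ 5`, every prime of multiplicative reduction is split multiplicative** (kernel
theorem per record: the pair is one of the six all-split records of `rest_five_le_all_splitAt`).
[cite: SilvermanAEC2009, VII.5 Prop. 5.1(a) and (b)] -/
theorem split_of_mult_of_mem_rest_five_le (r : Record) (hr : r ∈ allRecords) (h5 : 5 ≤ r.p)
    (hrest : r.restAt = true) (q : ℕ) [Fact q.Prime] :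
    haveI := (r.elliptic_and_minimal_of_check (check_of_mem_of_certified certified_allRecords hr)).1
    haveI := (r.elliptic_and_minimal_of_check (check_of_mem_of_certified certified_allRecords hr)).2
    r.curve.HasMultiplicativeReductionAtPrime q → r.curve.HasSplitMultiplicativeReductionAtPrime q := by
  have hc := check_of_mem_of_certified certified_allRecords hr
  haveI := (r.elliptic_and_minimal_of_check hc).1
  haveI := (r.elliptic_and_minimal_of_check hc).2
  intro hmult
  have hmem : r ∈ allRecords.filter fun r => 5 ≤ r.p ∧ r.restAt = true :=
    List.mem_filter.mpr ⟨hr, by simp [h5, hrest]⟩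
  have hall := List.all_eq_true.mp rest_five_le_all_splitAt.1 r hmem
  exact r.split_of_mult_of_all_splitAt hc hall q hmult

/-- **The Rest child's census cell `(138594b1, 5)` is ALL-SPLIT** (Cremona's minimal model, the model of
`not_hasErratumPrime_cell_138594b1_at5` / `classX6_cell_138594b1_at5`): `N = 2·3·23099` and every prime of
multiplicative reduction of `W` is split multiplicative — a kernel theorem, no claim.
[cite: Cremona2006, Table 1 (Cremona label 138594b1)] -/
theorem split_of_mult_cell_138594b1_at5 {W : WeierstrassCurve ℚ} [W.IsElliptic] [W.IsGloballyMinimal]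
    (hWeq : W = ⟨1, 0, 0, -1443, -21219⟩) (q : ℕ) [Fact q.Prime]
    (hmult : W.HasMultiplicativeReductionAtPrime q) : W.HasSplitMultiplicativeReductionAtPrime q := by
  obtain ⟨r, hr, hA, hall⟩ : ∃ r ∈ records14,
      r.ainvs = [1, 0, 0, -1443, -21219] ∧ (r.bad.all fun t => splitAt r.ainvs t.1) = true := by
    decide +kernel
  have hc := check_of_mem_of_certified certified_records14 hr
  have hW : W = r.curve := by rw [hWeq]; exact r.curve_eq hA
  subst hW
  exact r.split_of_mult_of_all_splitAt hc hall q hmult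

end Summit.BirchSwinnertonDyer.Rank1Residual.X6.PrintCert
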